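import Summits.NavierStokesRegularity.NavierStokesRegularity.Theorems.StableStrataDoorDefs

/-!
# StableStrataDoorWindowLimit — S26 «StableStrataDoor» (ε-STABLE STRATA: the open-neighbourhood principle K-stab(Φ,𝔖) and the
ε-AXISYMMETRIC Type-I door, uniform in the axis), part 2/6: defect lemmas, zoom covariance, K1-axi PROVED (§3–§4)

§3 elementary facts about the defect (continuity `continuous_axiDefect`, pointwise convergence `tendsto_axiDefect`,
`continuous_profileWindowField`, zoom covariance `profileWindowField_nsRescale`, zoom invariance
`hasSmallAxiDefectOn_nsRescale`; the rotation facts are the tree's `SereginSverak2009.rotZ_smul_vec` / `continuous_rotZ`) and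
§4 **K1-axi PROVED**: the axisymmetry-defect window limit along a velocity zoom (Fatou, `axiDefect_windowLimit`) and
`localPointZoomAxiDefect_holds : LocalPointZoomAxiDefect` (tree zoom `localPointZoomVelSlices` + `hasTypeIDecay_of_zoom`).

Door family of LADDER-NS N0 (local Type-I window doors S20–S26); THEOREMS-ONLY landing of the nsreg-p1 design
`run/shared/lean/pub/ns-regularity-ideate/ns-regularity-ideate-p1/r25/Sketch26.lean` (ROUND-25.md; sha16 bf87a99673b3e6ef,
farm rc 0 / 0 sorry), split by section into `StableStrataDoor{Defs, WindowLimit, AxiStability, Schema, Instances, Uniform}`,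
texts verbatim, namespace = file stem.  No route, no items (DIRECTOR-NS standing #32 (2); landing lane ns-door-S23-p1).
WHAT THIS IS NOT: not NS regularity (Clay (A)) and not a dent in `NoTypeII` (stmt-0056) — every statement lives INSIDE the
Type-I class; not the swirl hard cores (no Type-I-free statement); not the Type-I Liouville conjecture — only window-open
neighbourhoods of strata where it is already a theorem; `ε` comes from compactness and is NOT explicit.
-/

noncomputable section

set_option linter.dupNamespace false

namespace Summit.NavierStokesRegularity.NavierStokesRegularity.Theorems.StableStrataDoorWindowLimit

open MeasureTheory Set Function Filter Topology TopologicalSpace Metric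
open scoped RealInnerProductSpace NNReal ENNReal Topology Pointwise
open Literature.Analysis Literature.Analysis.FluidPDE
open Summit.NavierStokesRegularity.NavierStokesRegularity.Theorems.PoloidalWindowDoorPoloidalWindowRigidityWindow
open Summit.NavierStokesRegularity.NavierStokesRegularity.Theorems.ZoomReturnDoorDefs
open Summit.NavierStokesRegularity.NavierStokesRegularity.Theorems.ZoomReturnDoorWindowLimit
open Summit.NavierStokesRegularity.NavierStokesRegularity.Theorems.ZoomReturnDoorRemovableFactors
open Summit.NavierStokesRegularity.NavierStokesRegularity.Theorems.ZoomReturnDoorGlue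
open Summit.NavierStokesRegularity.NavierStokesRegularity.Theorems.ZoomReturnDoorExtraction
open Summit.NavierStokesRegularity.NavierStokesRegularity.Theorems.ZoomReturnDoorClassicalLimit
open Summit.NavierStokesRegularity.NavierStokesRegularity.Theorems.StableStrataDoorDefs

/-! ## §3 Elementary facts about the defect: linearity of rotations, continuity, convergence, zoom covariance -/


/-- continuity of the defect in the window variable for a continuous slice field. -/
theorem continuous_axiDefect (A : EuclideanSpace ℝ (Fin 3) ≃ₗᵢ[ℝ] EuclideanSpace ℝ (Fin 3))
    {F : EuclideanSpace ℝ (Fin 3) → EuclideanSpace ℝ (Fin 3)} (hF : Continuous F) (θ : ℝ) :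
    Continuous fun ζ => axiDefect A F θ ζ := by
  have c1 : Continuous fun ζ : EuclideanSpace ℝ (Fin 3) => rotZ θ (A.symm (F (A ζ))) :=
    (continuous_rotZ θ).comp (A.symm.continuous.comp (hF.comp A.continuous))
  have c2 : Continuous fun ζ : EuclideanSpace ℝ (Fin 3) => A.symm (F (A (rotZ θ ζ))) :=
    A.symm.continuous.comp (hF.comp (A.continuous.comp (continuous_rotZ θ)))
  exact (c1.sub c2).norm

/-- pointwise convergence of slice fields at the two points read by the defect ⇒ convergence of the defect. -/
theorem tendsto_axiDefect (A : EuclideanSpace ℝ (Fin 3) ≃ₗᵢ[ℝ] EuclideanSpace ℝ (Fin 3))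
    {Fn : ℕ → EuclideanSpace ℝ (Fin 3) → EuclideanSpace ℝ (Fin 3)} {F : EuclideanSpace ℝ (Fin 3) → EuclideanSpace ℝ (Fin 3)}
    (θ : ℝ) (ζ : EuclideanSpace ℝ (Fin 3)) (h1 : Tendsto (fun n => Fn n (A ζ)) atTop (𝓝 (F (A ζ))))
    (h2 : Tendsto (fun n => Fn n (A (rotZ θ ζ))) atTop (𝓝 (F (A (rotZ θ ζ))))) :
    Tendsto (fun n => axiDefect A (Fn n) θ ζ) atTop (𝓝 (axiDefect A F θ ζ)) := by
  have g1 : Tendsto (fun n => rotZ θ (A.symm (Fn n (A ζ)))) atTop (𝓝 (rotZ θ (A.symm (F (A ζ))))) :=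
    ((continuous_rotZ θ).tendsto _).comp ((A.symm.continuous.tendsto _).comp h1)
  have g2 : Tendsto (fun n => A.symm (Fn n (A (rotZ θ ζ)))) atTop (𝓝 (A.symm (F (A (rotZ θ ζ))))) :=
    (A.symm.continuous.tendsto _).comp h2
  exact (g1.sub g2).norm

/-- continuity of the profile window field of a field with continuous slice at `s`. -/
theorem continuous_profileWindowField {ν s : ℝ} {v : ℝ → EuclideanSpace ℝ (Fin 3) → EuclideanSpace ℝ (Fin 3)}
    (hvs : Continuous (v s)) : Continuous (profileWindowField ν v s) := by
  show Continuous fun y => (Real.sqrt (-s) / Real.sqrt ν * ν) • v s ((Real.sqrt (-s) / Real.sqrt ν) • y)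
  exact (hvs.comp (continuous_const_smul (Real.sqrt (-s) / Real.sqrt ν))).const_smul (Real.sqrt (-s) / Real.sqrt ν * ν)

/-- the profile window field is zoom COVARIANT: `profileWindowField(nsRescale λ u)(s) = profileWindowField(u)(λ² s)`. -/
theorem profileWindowField_nsRescale (ν : ℝ) (u : ℝ → EuclideanSpace ℝ (Fin 3) → EuclideanSpace ℝ (Fin 3)) {lam : ℝ}
    (hlam : 0 < lam) (s : ℝ) : profileWindowField ν (nsRescale lam u) s = profileWindowField ν u (lam ^ 2 * s) := by
  funext y
  have hsq : Real.sqrt (-(lam ^ 2 * s)) = lam * Real.sqrt (-s) := by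
    rw [show -(lam ^ 2 * s) = lam ^ 2 * (-s) by ring, Real.sqrt_mul (by positivity), Real.sqrt_sq hlam.le]
  simp only [profileWindowField, nsRescale_apply, smul_smul, hsq]
  have e1 : Real.sqrt (-s) / Real.sqrt ν * ν * lam = lam * Real.sqrt (-s) / Real.sqrt ν * ν := by ring
  have e2 : lam * (Real.sqrt (-s) / Real.sqrt ν) = lam * Real.sqrt (-s) / Real.sqrt ν := by ring
  rw [e1, e2]

/-- the small-defect hypothesis is zoom INVARIANT. -/
theorem hasSmallAxiDefectOn_nsRescale {ν : ℝ} {A : EuclideanSpace ℝ (Fin 3) ≃ₗᵢ[ℝ] EuclideanSpace ℝ (Fin 3)} {ε : ℝ}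
    {U : Set (EuclideanSpace ℝ (Fin 3))} {u : ℝ → EuclideanSpace ℝ (Fin 3) → EuclideanSpace ℝ (Fin 3)}
    (h : HasSmallAxiDefectOn ν A ε U u) {lam : ℝ} (hlam : 0 < lam) : HasSmallAxiDefectOn ν A ε U (nsRescale lam u) := by
  intro s hs θ
  rw [profileWindowField_nsRescale ν u hlam s]
  exact h (lam ^ 2 * s) (mul_neg_of_pos_of_neg (by positivity) hs) θ

/-! ## §4 K1-axi PROVED: the window limit along a velocity zoom (Fatou), and the zoom itself (tree) -/

section Core

variable {ν T : ℝ} {u : ℝ → EuclideanSpace ℝ (Fin 3) → EuclideanSpace ℝ (Fin 3)} {p : ℝ → EuclideanSpace ℝ (Fin 3) → ℝ}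
  {x₀ : EuclideanSpace ℝ (Fin 3)} {v : ℝ → EuclideanSpace ℝ (Fin 3) → EuclideanSpace ℝ (Fin 3)} {lam : ℕ → ℝ}

/-- **AXISYMMETRY-DEFECT WINDOW LIMIT.**  Along a velocity zoom `(λⱼ, v)` at `(x₀, T)`, an axisymmetry defect EVENTUALLY
`ε`-small on `U` leaves, at every profile time `s < 0` and angle `θ`, `∫_U axiDefect(profile window field) ≤ ε`. -/
theorem axiDefect_windowLimit (hν : 0 < ν) (hT : 0 < T) (hcl : IsClassicalNSSolutionOn (Ico 0 T) ν 0 u p)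
    (hlam : ∀ j, 0 < lam j) (hlam0 : Tendsto lam atTop (𝓝 0))
    (hconv : ∀ s < 0, ∀ y,
      Tendsto (fun j => (lam j / ν) • u (T + lam j ^ 2 * s / ν) (x₀ + lam j • y)) atTop (𝓝 (v s y)))
    (A : EuclideanSpace ℝ (Fin 3) ≃ₗᵢ[ℝ] EuclideanSpace ℝ (Fin 3)) {ε : ℝ} {U : Set (EuclideanSpace ℝ (Fin 3))}
    (hsmall : AxiDefectEventuallySmall T x₀ u A U ε) {s : ℝ} (hs : s < 0) (θ : ℝ) :
    ∫⁻ ζ in U, ENNReal.ofReal (axiDefect A (profileWindowField ν v s) θ ζ) ≤ ENNReal.ofReal ε := by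
  -- ## zoom times `tⱼ = T + λⱼ² s/ν → T⁻`
  have hns : 0 < -s := neg_pos.2 hs
  obtain ⟨t, ht⟩ : ∃ t : ℕ → ℝ, ∀ j, t j = T + lam j ^ 2 * s / ν := ⟨_, fun j => rfl⟩
  have hTt : ∀ j, T - t j = lam j ^ 2 * (-s) / ν := fun j => by rw [ht j]; ring
  have hc : ∀ j, 0 < lam j ^ 2 * (-s) / ν := fun j => div_pos (mul_pos (pow_pos (hlam j) 2) hns) hν
  have hc0 : Tendsto (fun j => lam j ^ 2 * (-s) / ν) atTop (𝓝 0) := by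
    simpa using ((hlam0.pow 2).mul_const (-s)).div_const ν
  have htT : Tendsto t atTop (𝓝[<] T) := by
    refine tendsto_nhdsWithin_iff.2 ⟨?_, Eventually.of_forall fun j => ?_⟩
    · have h1 : Tendsto (fun j => T - lam j ^ 2 * (-s) / ν) atTop (𝓝 (T - 0)) :=
        tendsto_const_nhds.sub hc0
      rw [sub_zero] at h1
      refine h1.congr fun j => ?_
      rw [ht j]; ring
    · show t j < T
      have h1 := hc j
      rw [← hTt j] at h1
      linarith
  have hev : ∀ᶠ j in atTop, t j ∈ Set.Ioo 0 T := htT.eventually (Ioo_mem_nhdsLT hT)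
  obtain ⟨j₀, hj₀⟩ := eventually_atTop.1 hev
  have hshift : Tendsto (fun j : ℕ => j + j₀) atTop atTop := tendsto_add_atTop_nat j₀
  have hsmallθ : ∀ᶠ t' in nhdsWithin T (Set.Iio T),
      ∫⁻ ζ in U, ENNReal.ofReal (axiDefect A (physWindowField T x₀ u t') θ ζ) ≤ ENNReal.ofReal ε :=
    hsmall.mono fun t' ht' => ht' θ
  have hsmallj : ∀ᶠ j in atTop,
      ∫⁻ ζ in U, ENNReal.ofReal (axiDefect A (physWindowField T x₀ u (t (j + j₀))) θ ζ) ≤ ENNReal.ofReal ε :=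
    (htT.comp hshift).eventually hsmallθ
  -- ## the similarity scale along the zoom: `√(T − tⱼ) = λⱼ σ`, `σ = √(−s)/√ν`
  set σ : ℝ := Real.sqrt (-s) / Real.sqrt ν with hσ
  have hsq : ∀ j, Real.sqrt (T - t j) = lam j * σ := by
    intro j
    rw [hTt j, hσ, Real.sqrt_div' _ hν.le, Real.sqrt_mul (pow_nonneg (hlam j).le 2), Real.sqrt_sq (hlam j).le]
    ring
  set W : ℕ → EuclideanSpace ℝ (Fin 3) → EuclideanSpace ℝ (Fin 3) := fun j y => physWindowField T x₀ u (t (j + j₀)) y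
    with hWdef
  have hW : ∀ (j : ℕ) (y : EuclideanSpace ℝ (Fin 3)), W j y =
      (σ * ν) • ((lam (j + j₀) / ν) • u (T + lam (j + j₀) ^ 2 * s / ν) (x₀ + lam (j + j₀) • (σ • y))) := by
    intro j y
    simp only [hWdef, physWindowField, hsq (j + j₀), smul_smul]
    rw [ht (j + j₀)]
    congr 1
    field_simp
  have hconvW : ∀ y, Tendsto (fun j => W j y) atTop (𝓝 (profileWindowField ν v s y)) := by
    intro y
    have h := ((hconv s hs (σ • y)).comp hshift).const_smul (σ * ν)
    have h' : Tendsto (fun j => W j y) atTop (𝓝 ((σ * ν) • v s (σ • y))) := h.congr fun j => (hW j y).symm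
    simpa only [profileWindowField, hσ] using h'
  have hconvD : ∀ ζ, Tendsto (fun j => axiDefect A (W j) θ ζ) atTop (𝓝 (axiDefect A (profileWindowField ν v s) θ ζ)) :=
    fun ζ => tendsto_axiDefect A θ ζ (hconvW (A ζ)) (hconvW (A (rotZ θ ζ)))
  -- measurability of the window defects: `u(tⱼ)` is smooth for the shifted times
  have hmem : ∀ j, t (j + j₀) ∈ Set.Ico 0 T := fun j =>
    ⟨(hj₀ (j + j₀) (Nat.le_add_left _ _)).1.le, (hj₀ (j + j₀) (Nat.le_add_left _ _)).2⟩
  have hWc : ∀ j, Continuous (W j) := fun j => by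
    show Continuous fun y => physWindowField T x₀ u (t (j + j₀)) y
    exact ((hcl.contDiff_velocity (hmem j)).continuous.comp
      (continuous_const.add (continuous_const_smul _))).const_smul (Real.sqrt (T - t (j + j₀)))
  have hDc : ∀ j, Continuous fun ζ => axiDefect A (W j) θ ζ := fun j => continuous_axiDefect A (hWc j) θ
  -- ## FATOU
  set g : EuclideanSpace ℝ (Fin 3) → ℝ≥0∞ := fun ζ => ENNReal.ofReal (axiDefect A (profileWindowField ν v s) θ ζ) with hg
  have hgjm : ∀ j, Measurable fun ζ => ENNReal.ofReal (axiDefect A (W j) θ ζ) :=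
    fun j => (ENNReal.continuous_ofReal.comp (hDc j)).measurable
  have hptw : ∀ ζ, Tendsto (fun j => ENNReal.ofReal (axiDefect A (W j) θ ζ)) atTop (𝓝 (g ζ)) :=
    fun ζ => ENNReal.tendsto_ofReal (hconvD ζ)
  have hFatou : ∫⁻ ζ in U, liminf (fun j => ENNReal.ofReal (axiDefect A (W j) θ ζ)) atTop ≤
      liminf (fun j => ∫⁻ ζ in U, ENNReal.ofReal (axiDefect A (W j) θ ζ)) atTop :=
    lintegral_liminf_le' (fun j => (hgjm j).aemeasurable)
  have hlim : (fun ζ => liminf (fun j => ENNReal.ofReal (axiDefect A (W j) θ ζ)) atTop) = g :=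
    funext fun ζ => (hptw ζ).liminf_eq
  have hsmallW : ∀ᶠ j in atTop, (∫⁻ ζ in U, ENNReal.ofReal (axiDefect A (W j) θ ζ)) ≤ ENNReal.ofReal ε := by
    filter_upwards [hsmallj] with j hj
    simpa only [hWdef] using hj
  have hlimle : liminf (fun j => ∫⁻ ζ in U, ENNReal.ofReal (axiDefect A (W j) θ ζ)) atTop ≤ ENNReal.ofReal ε :=
    liminf_le_of_frequently_le' hsmallW.frequently
  rw [hlim] at hFatou
  exact hFatou.trans hlimle

end Core

/-- **K1-axi HOLDS** (tree `localPointZoomVelSlices` = the velocity zoom, the local space–time Type-I bound passing to the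
decay `M/ν` by `hasTypeIDecay_of_zoom`, and `axiDefect_windowLimit`). -/
theorem localPointZoomAxiDefect_holds : LocalPointZoomAxiDefect := by
  intro ν T hν hT u p hcl hLH hdec x₀ ρ M hρ hM hnot
  obtain ⟨C, v, lam, hlam, hlam0, ⟨hrate, hcont, hmild, hdiv⟩, hsing, hconv⟩ :=
    Summit.NavierStokesRegularity.NavierStokesRegularity.Theorems.LocalVelCompTubeDoorLocalPointZoomVelSlices.localPointZoomVelSlices
      ν T hν hT u p hcl hLH hdec x₀ ρ M hρ
      (Summit.NavierStokesRegularity.NavierStokesRegularity.Theorems.PlaneStrainDoorZoomSpaceTimeDecay.timeTypeI_of_spaceTimeTypeI hM)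
      hnot
  have hdecay : HasTypeIDecay (M / ν) v :=
    Summit.NavierStokesRegularity.NavierStokesRegularity.Theorems.PlaneStrainDoorZoomSpaceTimeDecay.hasTypeIDecay_of_zoom
      hν hT hρ hlam hlam0 hM hconv
  exact ⟨C, v, ⟨hrate, hcont, hmild, hdiv⟩, hdecay, hsing, fun A U ε hsmall s hs θ =>
    axiDefect_windowLimit hν hT hcl hlam hlam0 hconv A hsmall hs θ⟩

end Summit.NavierStokesRegularity.NavierStokesRegularity.Theorems.StableStrataDoorWindowLimit
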